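import Literature.MathematicalPhysics.QuantumFieldTheory.Balaban1983to89.B6SectCPositivity

/-!
# `Balaban1983to89.B6Eq2118DeltaJInverse` — T. Bałaban, *Propagators and renormalization transformations for lattice gauge
# theories. II*, Commun. Math. Phys. **96** (1984) 223–250 [Balaban1984PropagatorsII], p. 243 (2.116)–(2.118) and p. 244 (2.120),
# with T. Bałaban, *… I*, Commun. Math. Phys. **95** (1984) 17–40 [Balaban1984PropagatorsI] p. 29 (1.65), p. 34 (1.95)/(1.100)/(1.103):
# the quadratic form `⟨B, Δ_jB⟩` of the two-scale construction IS `‖∂H_jB‖²` (the exponent of (2.117)) and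
# `Δ_j = (Q_jG_jQ_j*)⁻¹ − I` as an OPERATOR identity for the derived Sect. C operators of `…B6SectCOperators.TwoScaleData`

statement-level skeleton of published theorems with citation tags; proofs where landed; nothing here is a claim about the Yang–Mills mass gap

PDF held: `paper:balaban1984-cmp96-propagators-rt-ii` (journal page = PDF page + 222; pp. 243–246 [PDF 21–24] read from the
materialised text `~/.lit/texts/paper-balaban1984-cmp96-propagators-rt-ii/p0021.txt … p0024.txt`, this seat, 2026-08-21) and
`paper:balaban1984-cmp95-propagators-rt-i` (journal page = PDF page + 16; pp. 29, 34 [PDF 13, 18], text layer, this seat).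

PRINT (verbatim, text layer).  [B6] p. 243: *"The translation gives the factor exp[−½⟨H_jB, (Δ − ∂P_j∂*)H_jB⟩ + …] (2.113) …
Let us notice also that [(2.116)] and that in the last integral we may replace the exponential gauge fixing term by the
δ-function δ_R(R∂*A) using the Faddeev-Popov procedure. Then this integral gives the factor exp[−½‖∂H_jB‖²] (2.117) by (1.47)
and (1.64). Thus both factors are equal and in fact the quadratic forms are equal to ⟨B, Δ_jB⟩ given by (1.66) and satisfying
(1.67): γ₀‖∂₁B‖² ≦ ⟨B, Δ_jB⟩ ≦ γ₁‖∂₁B‖². (2.118)"*; p. 244: *"It is a Gaussian integral defined by the quadratic form (we take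
a = 1) ‖B↾_{Λ^c}‖² + L^{−2}‖(Q₁B)↾_{Λ′}‖² + ⟨B, Δ_jB⟩ (2.120) … The form is bounded from above"*; p. 246: *"H_j = G_jQ_j*(Q_jG_jQ_j*)⁻¹
(2.130) Thus this operator coincides with the operator introduced in Sect. D. … From these representations we obtain all the
necessary properties of the operators H_j, G̃_j. They follow from the Proposition 1.2 and from the formulas and the inequalities
(1.99)–(1.101) for Q_jG_jQ_j*."*; p. 248: *"The operator C̃ is an inverse to the operator of the quadratic form (2.120), hence it
is bounded from below by an inverse of an upper bound of this form."*  [B5] p. 29: *"we can verify all the properties of H_kB: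
Q_kH_kB = B, R∂*H_kB = 0, H_kB is a minimum of ½⟨∂A, ∂A⟩ on the hyperplane {A : Q_kA = B, R∂*A = 0} … The action Δ_k is thus
defined by ⟨B, Δ_kB⟩ = ⟨∂H_kB, ∂H_kB⟩. (1.65)"*; p. 34: *"R∂*GQ* = 0, QG∂R = 0 (1.95) … we have to investigate the operator QGQ*.
It is given by the formula (1.99) and can be bounded as follows a⁻¹(φ − 1)φ⁻¹ ≦ QGQ* ≦ a⁻¹I. (1.100) … H_kB = GQ*(QGQ*)⁻¹B. (1.103)"*.

CITATION HEADER (lean-in-tree rule) — WHAT IS REPRODUCED.  Phase-2 file of the `lit-balaban` typed skeleton (HOME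
`run/shared/lean/pub/lit-balaban/`), seat **p22 gen 9** (B6 fold owner r03, referee ref-4; this seat's lane = the Sect. C chain
(2.95)–(2.147), gens 1–8).  SKELETON rows **B6.Eq2.118** / **B6.Eq2.130** / **B6.Eq2.120** (decls of record: `…B6SectCOperators.Δj`,
`.Hj`, `.Ej`, `.Gj`, `.Sb` of p255063; `…B6SectCPositivity.h2118`, `.Qv_Hj`, `.hGj`, `.hEj`, `.inner_Sb` of p256498; the
Faddeev–Popov route (2.116) ⇒ (2.117) = `…B6Eq2117FaddeevPopov` p248983 — all untouched) WITH THE ALGEBRAIC CONTENT OF (2.117)–(2.118)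
AND OF THE SENTENCE AFTER (2.130) for the DERIVED operators of the abstract two-scale data `D : TwoScaleData` under the printed
identities `D.IsLattice` and the two printed positivity facts `D.Positive` (hypotheses by name, their own rows):
* §1 `G_j`, `(Q_jG_jQ_j*)⁻¹` are TWO-SIDED inverses and symmetric (`Gj_comp`, `comp_Gj`, `Ej_comp` (+ `…B6SectCPositivity.hEj`), `Gj_symm`,
  `QGQ_symm`, `Ej_symm`), `H_j = G_jQ_j*E_j` unfolds (`Hj_apply`);
* §2 **[B5] (1.95) for the two-scale `G_j`: `R_j∂*G_jQ_j* = 0`** (`Rj_dv_Gj_Qvs`), hence **`R_j∂*H_jB = 0`** (`Rj_dv_Hj`: the printed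
  `H_j` of (2.130) satisfies the gauge condition of [B5] p. 29 — the algebraic core of *"coincides with the operator introduced in
  Sect. D"*), and **(2.116)–(2.117): `⟨H_jB, (Δ − ∂P_j∂*)H_jB⟩ = ‖∂H_jB‖²`** (`form_Mj_Hj`, `inner_Δj_eq_norm_curl_sq` = [B5] (1.65)
  `⟨B, Δ_jB⟩ = ⟨∂H_jB, ∂H_jB⟩` for the Sect. C `Δ_j`) — a second, purely algebraic proof of the equality of the two exponents
  which print (and p248983) obtain by the Faddeev–Popov procedure;
* §3 **`Δ_j = (Q_jG_jQ_j*)⁻¹ − I` as linear maps** (`Mj_comp_Hj`, `Δj_eq_Ej_sub_id`, `inner_Δj_eq`), hence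
  `⟨B, (Q_jG_jQ_j*)⁻¹B⟩ = ‖B‖² + ‖∂H_jB‖² ≥ ‖B‖²` (`inner_Ej_eq`, `norm_sq_le_inner_Ej`) and **the upper half of [B5] (1.100) at
  `a = 1`, `Q_jG_jQ_j* ≤ I`, for the two-scale `G_j`** (`inner_QGQ_le`, `norm_QGQ_le`) — with no momentum representation;
* §4 the operator of the form (2.120): **`Q″*aQ″ + Δ_j = Q″*aQ″ + (Q_jG_jQ_j*)⁻¹ − I`** (`Sb_eq`, `inner_Sb_eq`), and p. 244 *"The form
  is bounded from above"* / p. 248 *"bounded from below by an inverse of an upper bound of this form"* REDUCED to the printed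
  one-level input (1.100)–(1.101) (*"bounded from below … The same property holds for QGQ*"*): a lower bound `γ‖ω‖² ≤ ⟨ω, Q_jG_jQ_j*ω⟩`
  gives `⟨B,(Q_jG_jQ_j*)⁻¹B⟩ ≤ γ⁻¹‖B‖²` (`inner_Ej_le_of_QGQ_ge`) and `⟨B,(Q″*aQ″ + Δ_j)B⟩ ≤ ⟨Q″B, aQ″B⟩ + (γ⁻¹ − 1)‖B‖²`
  (`inner_Sb_le_of_QGQ_ge`).
THEOREMS ONLY (no definition, no `def … : Prop`, nothing is a named unproved fact; standard axioms).  HONEST SCOPE: finite-dimensional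
inner-product-space model of `…B6SectCOperators` (`G_j` with weight `a = 1`); the lower bound `γ` of (1.100)–(1.101) is a displayed
hypothesis where used (row B5.Eq1.101, proved on the torus by `…B5Ineq1101QGQTorus`, other carriers); the (2.118) constants
`γ₀, γ₁` (row B6.Eq2.118 = [B5] (1.67)) are NOT re-derived here; NOT summit progress.  Companion (same seat, gen 9):
`…B6Eq2130TwoScaleV1Landau` identifies these operators for the concrete two-scale V1 data `tsV1` with [B5]/[BIJ85]'s `H_k`, `Δ_k`.
-/

noncomputable section

open scoped InnerProductSpace

namespace Literature.MathematicalPhysics.QuantumFieldTheory.Balaban1983to89.B6Eq2118DeltaJInverse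

open B6CovarianceOperator B6SectCOperators B6SectCOperators.TwoScaleData B6SectCPositivity

variable {A B W T Bs V : Type*}
  [NormedAddCommGroup A] [InnerProductSpace ℝ A] [FiniteDimensional ℝ A]
  [NormedAddCommGroup B] [InnerProductSpace ℝ B] [FiniteDimensional ℝ B]
  [NormedAddCommGroup W] [InnerProductSpace ℝ W] [FiniteDimensional ℝ W]
  [NormedAddCommGroup T] [InnerProductSpace ℝ T] [FiniteDimensional ℝ T]
  [NormedAddCommGroup Bs] [InnerProductSpace ℝ Bs] [FiniteDimensional ℝ Bs]
  [NormedAddCommGroup V] [InnerProductSpace ℝ V] [FiniteDimensional ℝ V]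
  {D : TwoScaleData A B W T Bs V}

/-! ## §1  `G_j = (Δ − ∂P_j∂* + Q_j*Q_j)⁻¹` and `(Q_jG_jQ_j*)⁻¹` are two-sided inverses; `H_j = G_jQ_j*(Q_jG_jQ_j*)⁻¹` -/

/-- `(M_j + Q_j*Q_j)G_j = I`, `M_j = Δ − ∂P_j∂*`. [cite: Balaban1984PropagatorsII, (2.130) p.246] -/
theorem comp_Gj (hL : D.IsLattice) (hP : D.Positive) :
    (D.Mj + LinearMap.adjoint D.Qv ∘ₗ D.Qv) ∘ₗ D.Gj = LinearMap.id :=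
  comp_inverse _ (MjQ_pos hL hP)

/-- `G_j(M_j + Q_j*Q_j) = I`. [cite: Balaban1984PropagatorsII, (2.130) p.246] -/
theorem Gj_comp (hL : D.IsLattice) (hP : D.Positive) :
    D.Gj ∘ₗ (D.Mj + LinearMap.adjoint D.Qv ∘ₗ D.Qv) = LinearMap.id :=
  inverse_comp _ (MjQ_pos hL hP)

/-- pointwise: `M_j(G_jx) + Q_j*Q_j(G_jx) = x`. [cite: Balaban1984PropagatorsII, (2.130) p.246] -/
theorem Mj_Gj_add (hL : D.IsLattice) (hP : D.Positive) (x : A) :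
    D.Mj (D.Gj x) + LinearMap.adjoint D.Qv (D.Qv (D.Gj x)) = x := by
  have h := LinearMap.congr_fun (comp_Gj hL hP) x
  simpa using h

/-- `G_j` is symmetric. [cite: Balaban1984PropagatorsII, (2.130) p.246] -/
theorem Gj_symm (hL : D.IsLattice) (hP : D.Positive) (x y : A) : ⟪D.Gj x, y⟫_ℝ = ⟪x, D.Gj y⟫_ℝ :=
  inverse_symm _ (MjQ_symm hL) (MjQ_pos hL hP) x y

/-- `Q_jG_jQ_j*` is symmetric. [cite: Balaban1984PropagatorsI, (1.99)–(1.100) p.34] -/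
theorem QGQ_symm (hL : D.IsLattice) (hP : D.Positive) (x y : Bs) :
    ⟪(D.Qv ∘ₗ D.Gj ∘ₗ LinearMap.adjoint D.Qv) x, y⟫_ℝ = ⟪x, (D.Qv ∘ₗ D.Gj ∘ₗ LinearMap.adjoint D.Qv) y⟫_ℝ := by
  simp only [LinearMap.coe_comp, Function.comp_apply]
  rw [← LinearMap.adjoint_inner_right D.Qv, Gj_symm hL hP, LinearMap.adjoint_inner_left]

/-- `(Q_jG_jQ_j*)⁻¹(Q_jG_jQ_j*) = I`. [cite: Balaban1984PropagatorsII, (2.130) p.246] -/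
theorem Ej_comp (hL : D.IsLattice) (hP : D.Positive) :
    D.Ej ∘ₗ (D.Qv ∘ₗ D.Gj ∘ₗ LinearMap.adjoint D.Qv) = LinearMap.id :=
  inverse_comp _ (QGQ_pos hL hP)

/-- pointwise: `Q_jG_jQ_j*((Q_jG_jQ_j*)⁻¹b) = b` (`…B6SectCPositivity.hEj`). [cite: Balaban1984PropagatorsII, (2.130) p.246] -/
theorem QGQ_Ej (hL : D.IsLattice) (hP : D.Positive) (b : Bs) :
    D.Qv (D.Gj (LinearMap.adjoint D.Qv (D.Ej b))) = b := by
  have h := LinearMap.congr_fun (hEj hL hP) b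
  simpa using h

/-- pointwise: `(Q_jG_jQ_j*)⁻¹(Q_jG_jQ_j*ω) = ω`. [cite: Balaban1984PropagatorsII, (2.130) p.246] -/
theorem Ej_QGQ (hL : D.IsLattice) (hP : D.Positive) (ω : Bs) :
    D.Ej (D.Qv (D.Gj (LinearMap.adjoint D.Qv ω))) = ω := by
  have h := LinearMap.congr_fun (Ej_comp hL hP) ω
  simpa using h

/-- `(Q_jG_jQ_j*)⁻¹` is symmetric. [cite: Balaban1984PropagatorsII, (2.130) p.246] -/
theorem Ej_symm (hL : D.IsLattice) (hP : D.Positive) (x y : Bs) : ⟪D.Ej x, y⟫_ℝ = ⟪x, D.Ej y⟫_ℝ :=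
  inverse_symm _ (QGQ_symm hL hP) (QGQ_pos hL hP) x y

/-- `(Q_jG_jQ_j*)⁻¹` is positive definite. [cite: Balaban1984PropagatorsII, p.228 + (2.130) p.246] -/
theorem Ej_pos (hL : D.IsLattice) (hP : D.Positive) (b : Bs) (hb : b ≠ 0) : 0 < ⟪b, D.Ej b⟫_ℝ :=
  inverse_pos _ (QGQ_pos hL hP) b hb

/-- **(2.130) unfolds: `H_jb = G_j(Q_j*((Q_jG_jQ_j*)⁻¹b))`.** [cite: Balaban1984PropagatorsII, (2.130) p.246] -/
theorem Hj_apply (b : Bs) : D.Hj b = D.Gj (LinearMap.adjoint D.Qv (D.Ej b)) := rfl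

/-! ## §2  [B5] (1.95) `R_j∂*G_jQ_j* = 0` for the two-scale `G_j`; `R_j∂*H_jB = 0`; (2.116) = (2.117) algebraically -/

/-- For a gauge function `λ ∈ N(Q′_j)`: `⟨∂λ, M_jx⟩ = ⟨Δλ, R_j∂*x⟩` (`curl ∂ = 0`, `∂*∂ = Δ`, `P_j = I − R_j`).
[cite: Balaban1984PropagatorsII, (2.97) p.240 + (2.112) p.243] -/
theorem inner_grad_Mj (hL : D.IsLattice) (n : ↥D.Nj) (x : A) :
    ⟪D.grad (n : B), D.Mj x⟫_ℝ = ⟪D.lap (n : B), D.Rj (D.dv x)⟫_ℝ := by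
  have h1 : ⟪D.grad (n : B), D.lapV x⟫_ℝ = ⟪D.lap (n : B), D.dv x⟫_ℝ := by
    rw [hL.lapV_form, hL.curl_grad, inner_zero_left, zero_add, hL.dv_grad]
  have h2 : ⟪D.grad (n : B), D.grad (D.Pj (D.dv x))⟫_ℝ = ⟪D.lap (n : B), D.dv x⟫_ℝ - ⟪D.lap (n : B), D.Rj (D.dv x)⟫_ℝ := by
    rw [hL.grad_adj, hL.dv_grad, ← lap_symm hL, Pj_apply, inner_sub_right, ← Rj_apply]
  rw [Mj_eq, LinearMap.sub_apply, inner_sub_right, LinearMap.comp_apply, LinearMap.comp_apply, h1, h2]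
  ring

/-- For `λ ∈ N(Q′_j)`: `Q_j∂λ = ∂₁Q′_jλ = 0` ((2.103)). [cite: Balaban1984PropagatorsII, (2.103) p.241] -/
theorem Qv_grad_eq_zero (hL : D.IsLattice) (n : ↥D.Nj) : D.Qv (D.grad (n : B)) = 0 := by
  rw [hL.Qv_grad, show D.Qp (n : B) = 0 from n.2, map_zero]

/-- `R_j∂*x` lies in `ΔN(Q′_j)`. [cite: Balaban1984PropagatorsII, (2.97) p.240] -/
theorem Rj_dv_mem (x : A) : D.Rj (D.dv x) ∈ D.Nj.map D.lap := by
  rw [Rj_apply]; exact Submodule.starProjection_apply_mem _ _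

/-- A vector of `ΔN(Q′_j)` orthogonal to every `Δλ`, `λ ∈ N(Q′_j)`, vanishes. [cite: Balaban1984PropagatorsII, (2.10)–(2.11) p.225] -/
theorem eq_zero_of_mem_of_orth {u : B} (hu : u ∈ D.Nj.map D.lap) (h : ∀ n : ↥D.Nj, ⟪D.lap (n : B), u⟫_ℝ = 0) : u = 0 := by
  obtain ⟨m, hm, rfl⟩ := hu
  have := h ⟨m, hm⟩
  rwa [real_inner_self_eq_norm_sq, sq_eq_zero_iff, norm_eq_zero] at this

/-- **[B5] (1.95) `R∂*GQ* = 0` for the two-scale `G_j`: `R_j∂*G_jQ_j*b = 0`** — pair `(M_j + Q_j*Q_j)G_jQ_j*b = Q_j*b` with `∂λ`,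
`λ ∈ N(Q′_j)`: the `Q_j`-terms die by (2.103), leaving `⟨Δλ, R_j∂*G_jQ_j*b⟩ = 0`. [cite: Balaban1984PropagatorsI, (1.95) p.34] -/
theorem Rj_dv_Gj_Qvs (hL : D.IsLattice) (hP : D.Positive) (b : Bs) :
    D.Rj (D.dv (D.Gj (LinearMap.adjoint D.Qv b))) = 0 := by
  set x := D.Gj (LinearMap.adjoint D.Qv b) with hx
  refine eq_zero_of_mem_of_orth (Rj_dv_mem x) fun n => ?_
  have hsum := Mj_Gj_add hL hP (LinearMap.adjoint D.Qv b)
  rw [← hx] at hsum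
  have h1 : ⟪D.grad (n : B), D.Mj x + LinearMap.adjoint D.Qv (D.Qv x)⟫_ℝ = ⟪D.grad (n : B), LinearMap.adjoint D.Qv b⟫_ℝ := by
    rw [hsum]
  rw [inner_add_right, inner_grad_Mj hL, LinearMap.adjoint_inner_right, LinearMap.adjoint_inner_right,
    Qv_grad_eq_zero hL, inner_zero_left, inner_zero_left, add_zero] at h1
  exact h1

/-- **`R_j∂*H_jB = 0`**: the `H_j` of (2.130) satisfies the gauge condition of [B5] p. 29 (*"R∂*H_kB = 0"*) — with `Q_jH_j = I`
(`…B6SectCPositivity.Qv_Hj`) and minimality (`Hj_crit`) this is *"coincides with the operator introduced in Sect. D"*.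
[cite: Balaban1984PropagatorsII, (2.130) p.246] -/
theorem Rj_dv_Hj (hL : D.IsLattice) (hP : D.Positive) (b : Bs) : D.Rj (D.dv (D.Hj b)) = 0 := by
  rw [Hj_apply]; exact Rj_dv_Gj_Qvs hL hP _

/-- **(2.116) = (2.117) for the exponents: `⟨H_jB, (Δ − ∂P_j∂*)H_jB⟩ = ‖∂H_jB‖²`** (`∂` = the plaquette curl; the gauge term
`‖R_j∂*H_jB‖²` of the form vanishes). [cite: Balaban1984PropagatorsII, (2.116)–(2.117) p.243] -/
theorem form_Mj_Hj (hL : D.IsLattice) (hP : D.Positive) (b : Bs) : ⟪D.Hj b, D.Mj (D.Hj b)⟫_ℝ = ‖D.curl (D.Hj b)‖ ^ 2 := by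
  rw [form_Mj hL, Rj_dv_Hj hL hP, norm_zero, zero_pow two_ne_zero, add_zero]

/-- **(2.118)/(1.65): `⟨B, Δ_jB⟩ = ⟨∂H_jB, ∂H_jB⟩ = ‖∂H_jB‖²`** for the Sect. C `Δ_j = H_j*(Δ − ∂P_j∂*)H_j` (*"the quadratic forms
are equal to ⟨B, Δ_jB⟩ given by (1.66)"*). [cite: Balaban1984PropagatorsII, (2.118) p.243] -/
theorem inner_Δj_eq_norm_curl_sq (hL : D.IsLattice) (hP : D.Positive) (b : Bs) : ⟪b, D.Δj b⟫_ℝ = ‖D.curl (D.Hj b)‖ ^ 2 := by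
  rw [← h2118, form_Mj_Hj hL hP]

/-- `⟨B, Δ_jB⟩ ≥ 0`. [cite: Balaban1984PropagatorsII, (2.118) p.243] -/
theorem inner_Δj_nonneg (hL : D.IsLattice) (hP : D.Positive) (b : Bs) : 0 ≤ ⟪b, D.Δj b⟫_ℝ := by
  rw [inner_Δj_eq_norm_curl_sq hL hP]; positivity

/-! ## §3  `Δ_j = (Q_jG_jQ_j*)⁻¹ − I`; [B5] (1.100) upper half `Q_jG_jQ_j* ≤ I` for the two-scale `G_j` -/

/-- **`(Δ − ∂P_j∂*)H_j = Q_j*((Q_jG_jQ_j*)⁻¹ − I)`**: from `(M_j + Q_j*Q_j)G_j = I` and `Q_jH_j = I`.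
[cite: Balaban1984PropagatorsII, (2.113) p.243 + (2.130) p.246] -/
theorem Mj_comp_Hj (hL : D.IsLattice) (hP : D.Positive) :
    D.Mj ∘ₗ D.Hj = LinearMap.adjoint D.Qv ∘ₗ (D.Ej - LinearMap.id) := by
  refine LinearMap.ext fun b => ?_
  have h := Mj_Gj_add hL hP (LinearMap.adjoint D.Qv (D.Ej b))
  rw [← Hj_apply, Qv_Hj hL hP] at h
  rw [LinearMap.comp_apply, LinearMap.comp_apply, LinearMap.sub_apply, LinearMap.id_apply, map_sub]
  exact eq_sub_of_add_eq h

/-- pointwise. [cite: Balaban1984PropagatorsII, (2.113) p.243 + (2.130) p.246] -/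
theorem Mj_Hj (hL : D.IsLattice) (hP : D.Positive) (b : Bs) :
    D.Mj (D.Hj b) = LinearMap.adjoint D.Qv (D.Ej b) - LinearMap.adjoint D.Qv b := by
  have h := LinearMap.congr_fun (Mj_comp_Hj hL hP) b
  simpa [map_sub] using h

/-- **`Δ_j = H_j*(Δ − ∂P_j∂*)H_j = (Q_jG_jQ_j*)⁻¹ − I` as linear maps** (weight `a = 1`): `H_j*Q_j* = (Q_jH_j)* = I`.
[cite: Balaban1984PropagatorsII, (2.118) p.243 + (2.130) p.246] -/
theorem Δj_eq_Ej_sub_id (hL : D.IsLattice) (hP : D.Positive) : D.Δj = D.Ej - LinearMap.id := by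
  refine LinearMap.ext fun b => ext_inner_left ℝ fun x => ?_
  rw [show D.Δj b = LinearMap.adjoint D.Hj (D.Mj (D.Hj b)) from rfl, LinearMap.adjoint_inner_right, Mj_Hj hL hP,
    inner_sub_right, LinearMap.adjoint_inner_right, LinearMap.adjoint_inner_right, Qv_Hj hL hP, LinearMap.sub_apply,
    LinearMap.id_apply, inner_sub_right]

/-- pointwise: `Δ_jb = (Q_jG_jQ_j*)⁻¹b − b`. [cite: Balaban1984PropagatorsII, (2.118) p.243 + (2.130) p.246] -/
theorem Δj_apply (hL : D.IsLattice) (hP : D.Positive) (b : Bs) : D.Δj b = D.Ej b - b := by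
  rw [Δj_eq_Ej_sub_id hL hP, LinearMap.sub_apply, LinearMap.id_apply]

/-- **`⟨B, Δ_jB⟩ = ⟨B, (Q_jG_jQ_j*)⁻¹B⟩ − ‖B‖²`.** [cite: Balaban1984PropagatorsII, (2.118) p.243 + (2.130) p.246] -/
theorem inner_Δj_eq (hL : D.IsLattice) (hP : D.Positive) (b : Bs) : ⟪b, D.Δj b⟫_ℝ = ⟪b, D.Ej b⟫_ℝ - ‖b‖ ^ 2 := by
  rw [Δj_apply hL hP, inner_sub_right, real_inner_self_eq_norm_sq]

/-- **`⟨B, (Q_jG_jQ_j*)⁻¹B⟩ = ‖B‖² + ‖∂H_jB‖²`** (`(Q_jG_jQ_j*)⁻¹ = I + Δ_j` in the form sense). [cite: Balaban1984PropagatorsII, (2.118) p.243 + (2.130) p.246] -/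
theorem inner_Ej_eq (hL : D.IsLattice) (hP : D.Positive) (b : Bs) : ⟪b, D.Ej b⟫_ℝ = ‖b‖ ^ 2 + ‖D.curl (D.Hj b)‖ ^ 2 := by
  have h := inner_Δj_eq hL hP b
  rw [inner_Δj_eq_norm_curl_sq hL hP] at h
  linarith

/-- `(Q_jG_jQ_j*)⁻¹ ≥ I`: `‖B‖² ≤ ⟨B, (Q_jG_jQ_j*)⁻¹B⟩`. [cite: Balaban1984PropagatorsI, (1.100) p.34] -/
theorem norm_sq_le_inner_Ej (hL : D.IsLattice) (hP : D.Positive) (b : Bs) : ‖b‖ ^ 2 ≤ ⟪b, D.Ej b⟫_ℝ := by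
  rw [inner_Ej_eq hL hP]; nlinarith [sq_nonneg ‖D.curl (D.Hj b)‖]

/-- `‖Q_jG_jQ_j*ω‖ ≤ ‖ω‖`. [cite: Balaban1984PropagatorsI, (1.100) p.34] -/
theorem norm_QGQ_le (hL : D.IsLattice) (hP : D.Positive) (ω : Bs) :
    ‖D.Qv (D.Gj (LinearMap.adjoint D.Qv ω))‖ ≤ ‖ω‖ := by
  set b := D.Qv (D.Gj (LinearMap.adjoint D.Qv ω)) with hb
  -- `⟨b, E_jb⟩ = ⟨b, ω⟩` since `E_j(Q_jG_jQ_j*ω) = ω`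
  have h1 : ⟪b, D.Ej b⟫_ℝ = ⟪b, ω⟫_ℝ := by rw [hb, Ej_QGQ hL hP]
  have h2 : ‖b‖ ^ 2 ≤ ⟪b, ω⟫_ℝ := h1 ▸ norm_sq_le_inner_Ej hL hP b
  have h3 : ⟪b, ω⟫_ℝ ≤ ‖b‖ * ‖ω‖ := real_inner_le_norm _ _
  by_cases hb0 : b = 0
  · rw [hb0, norm_zero]; exact norm_nonneg _
  · have hbpos : 0 < ‖b‖ := norm_pos_iff.mpr hb0
    nlinarith

/-- **[B5] (1.100), upper half, at `a = 1`, for the two-scale `G_j`: `⟨ω, Q_jG_jQ_j*ω⟩ ≤ ‖ω‖²`** (from `M_j ≥ 0` through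
`(Q_jG_jQ_j*)⁻¹ = I + Δ_j`; no momentum representation). [cite: Balaban1984PropagatorsI, (1.100) p.34] -/
theorem inner_QGQ_le (hL : D.IsLattice) (hP : D.Positive) (ω : Bs) :
    ⟪ω, (D.Qv ∘ₗ D.Gj ∘ₗ LinearMap.adjoint D.Qv) ω⟫_ℝ ≤ ‖ω‖ ^ 2 := by
  simp only [LinearMap.coe_comp, Function.comp_apply]
  calc ⟪ω, D.Qv (D.Gj (LinearMap.adjoint D.Qv ω))⟫_ℝ ≤ ‖ω‖ * ‖D.Qv (D.Gj (LinearMap.adjoint D.Qv ω))‖ := real_inner_le_norm _ _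
    _ ≤ ‖ω‖ * ‖ω‖ := by gcongr; exact norm_QGQ_le hL hP ω
    _ = ‖ω‖ ^ 2 := (sq ‖ω‖).symm

/-- `0 ≤ ⟨ω, Q_jG_jQ_j*ω⟩ ≤ ‖ω‖²` — the two-sided form of (1.100) at `a = 1` available without the lower constant.
[cite: Balaban1984PropagatorsI, (1.100) p.34] -/
theorem inner_QGQ_nonneg (hL : D.IsLattice) (hP : D.Positive) (ω : Bs) :
    0 ≤ ⟪ω, (D.Qv ∘ₗ D.Gj ∘ₗ LinearMap.adjoint D.Qv) ω⟫_ℝ :=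
  nonneg_of_posDef _ (QGQ_pos hL hP) ω

/-! ## §4  The operator of the form (2.120) in terms of `Q_jG_jQ_j*`; its upper bound from the (1.100)–(1.101) lower bound -/

/-- **`Q″*aQ″ + Δ_j = Q″*aQ″ + (Q_jG_jQ_j*)⁻¹ − I`** — the operator of the Gaussian (2.119)/(2.120).
[cite: Balaban1984PropagatorsII, (2.119)–(2.120) pp.243–244] -/
theorem Sb_eq (hL : D.IsLattice) (hP : D.Positive) :
    D.Sb = LinearMap.adjoint D.Qpp ∘ₗ D.a ∘ₗ D.Qpp + (D.Ej - LinearMap.id) := by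
  rw [Sb, Δj_eq_Ej_sub_id hL hP]

/-- **the form (2.120): `⟨B, (Q″*aQ″ + Δ_j)B⟩ = ⟨Q″B, aQ″B⟩ + ⟨B, (Q_jG_jQ_j*)⁻¹B⟩ − ‖B‖²`.**
[cite: Balaban1984PropagatorsII, (2.120) p.244] -/
theorem inner_Sb_eq (hL : D.IsLattice) (hP : D.Positive) (b : Bs) :
    ⟪b, D.Sb b⟫_ℝ = ⟪D.Qpp b, D.a (D.Qpp b)⟫_ℝ + ⟪b, D.Ej b⟫_ℝ - ‖b‖ ^ 2 := by
  rw [Sb, LinearMap.add_apply, inner_add_right, inner_Δj_eq hL hP]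
  simp only [LinearMap.coe_comp, Function.comp_apply]
  rw [LinearMap.adjoint_inner_right]
  ring

/-- … `= ⟨Q″B, aQ″B⟩ + ‖∂H_jB‖²` (the (2.112) form at `A = H_jB`, cf. `…B6SectCPositivity.inner_Sb`).
[cite: Balaban1984PropagatorsII, (2.112) p.243 + (2.120) p.244] -/
theorem inner_Sb_eq_curl (hL : D.IsLattice) (hP : D.Positive) (b : Bs) :
    ⟪b, D.Sb b⟫_ℝ = ⟪D.Qpp b, D.a (D.Qpp b)⟫_ℝ + ‖D.curl (D.Hj b)‖ ^ 2 := by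
  rw [inner_Sb_eq hL hP, inner_Ej_eq hL hP]; ring

/-- **p. 246 / p. 248 reduced to (1.100)–(1.101)**: a lower bound `γ‖ω‖² ≤ ⟨ω, Q_jG_jQ_j*ω⟩` (*"bounded from below … The same property
holds for QGQ*"*, [B5] p. 34) gives `⟨B, (Q_jG_jQ_j*)⁻¹B⟩ ≤ γ⁻¹‖B‖²`. [cite: Balaban1984PropagatorsI, (1.100)–(1.101) p.34] -/
theorem inner_Ej_le_of_QGQ_ge (hL : D.IsLattice) (hP : D.Positive) {γ : ℝ} (hγ : 0 < γ)
    (hlow : ∀ ω : Bs, γ * ‖ω‖ ^ 2 ≤ ⟪ω, (D.Qv ∘ₗ D.Gj ∘ₗ LinearMap.adjoint D.Qv) ω⟫_ℝ) (b : Bs) :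
    ⟪b, D.Ej b⟫_ℝ ≤ γ⁻¹ * ‖b‖ ^ 2 := by
  set ω := D.Ej b with hω
  -- `γ‖E_jb‖² ≤ ⟨E_jb, Q_jG_jQ_j*E_jb⟩ = ⟨E_jb, b⟩ ≤ ‖E_jb‖‖b‖`
  have h1 : ⟪ω, (D.Qv ∘ₗ D.Gj ∘ₗ LinearMap.adjoint D.Qv) ω⟫_ℝ = ⟪ω, b⟫_ℝ := by
    simp only [LinearMap.coe_comp, Function.comp_apply]
    rw [hω, QGQ_Ej hL hP]
  have h2 : γ * ‖ω‖ ^ 2 ≤ ‖ω‖ * ‖b‖ := (hlow ω).trans (h1 ▸ real_inner_le_norm _ _)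
  have h3 : ‖ω‖ ≤ γ⁻¹ * ‖b‖ := by
    by_cases hω0 : ω = 0
    · rw [hω0, norm_zero]; positivity
    · have hωpos : 0 < ‖ω‖ := norm_pos_iff.mpr hω0
      have h4 : γ * ‖ω‖ ≤ ‖b‖ := by
        have : γ * ‖ω‖ * ‖ω‖ ≤ ‖b‖ * ‖ω‖ := by nlinarith [h2]
        exact le_of_mul_le_mul_right this hωpos
      rw [inv_mul_eq_div, le_div_iff₀ hγ, mul_comm]
      exact h4
  calc ⟪b, D.Ej b⟫_ℝ = ⟪ω, b⟫_ℝ := by rw [hω, real_inner_comm]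
    _ ≤ ‖ω‖ * ‖b‖ := real_inner_le_norm _ _
    _ ≤ γ⁻¹ * ‖b‖ * ‖b‖ := by gcongr
    _ = γ⁻¹ * ‖b‖ ^ 2 := by ring

/-- **p. 244 *"The form is bounded from above"*, quantitatively from the one-level input**: with `γ‖ω‖² ≤ ⟨ω, Q_jG_jQ_j*ω⟩`,
`⟨B, (Q″*aQ″ + Δ_j)B⟩ ≤ ⟨Q″B, aQ″B⟩ + (γ⁻¹ − 1)‖B‖²` (so, with p. 248, `C̃^{(j)}_Λ` is bounded below on the axial `B` by the inverse
of this bound plus that of `Q″*aQ″`). [cite: Balaban1984PropagatorsII, (2.120) p.244 + p.248] -/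
theorem inner_Sb_le_of_QGQ_ge (hL : D.IsLattice) (hP : D.Positive) {γ : ℝ} (hγ : 0 < γ)
    (hlow : ∀ ω : Bs, γ * ‖ω‖ ^ 2 ≤ ⟪ω, (D.Qv ∘ₗ D.Gj ∘ₗ LinearMap.adjoint D.Qv) ω⟫_ℝ) (b : Bs) :
    ⟪b, D.Sb b⟫_ℝ ≤ ⟪D.Qpp b, D.a (D.Qpp b)⟫_ℝ + (γ⁻¹ - 1) * ‖b‖ ^ 2 := by
  rw [inner_Sb_eq hL hP]
  have h := inner_Ej_le_of_QGQ_ge hL hP hγ hlow b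
  linarith

/-- … and the corresponding bound for `⟨B, Δ_jB⟩` alone: `⟨B, Δ_jB⟩ ≤ (γ⁻¹ − 1)‖B‖²` (an upper bound of the (2.118) form by the
(1.100)–(1.101) constant). [cite: Balaban1984PropagatorsII, (2.118) p.243] -/
theorem inner_Δj_le_of_QGQ_ge (hL : D.IsLattice) (hP : D.Positive) {γ : ℝ} (hγ : 0 < γ)
    (hlow : ∀ ω : Bs, γ * ‖ω‖ ^ 2 ≤ ⟪ω, (D.Qv ∘ₗ D.Gj ∘ₗ LinearMap.adjoint D.Qv) ω⟫_ℝ) (b : Bs) :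
    ⟪b, D.Δj b⟫_ℝ ≤ (γ⁻¹ - 1) * ‖b‖ ^ 2 := by
  rw [inner_Δj_eq hL hP]
  have h := inner_Ej_le_of_QGQ_ge hL hP hγ hlow b
  linarith

end Literature.MathematicalPhysics.QuantumFieldTheory.Balaban1983to89.B6Eq2118DeltaJInverse

end
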